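import Literature.NumberTheory.LFunctions.ConreyIwaniec2002Prop64OfV1
import Literature.NumberTheory.LFunctions.ConreyIwaniec2002ThetaOmega
import HarnessLib

/-!
# Conrey–Iwaniec (2002), Proposition 6.4 — discharged

B. Conrey, H. Iwaniec, *Spacing of zeros of Hecke `L`-functions and the class number problem*,
Acta Arith. 103 (2002) 259–312, Proposition 6.4 (6.52) [held text `paper:arxiv-math_0111012`,
p0014–p0017]: "Let `λ(n)` be the coefficients of an automorphic form given by Hecke characters of the
imaginary quadratic field `K = ℚ(√−q)` … Then `∫_T^{2T}|Σ_n a(n)λ(n)n^{−1/2−it}|²dt ≪ Tℒ(T)log q`."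
The typed named fact `conreyIwaniec2002_proposition64` (`ConreyIwaniec2002SpacingMechanism.lean`,
class-group characters, `T ≥ q^{65}`) is now a KERNEL THEOREM: the last registered stub of the cell
`landau-siegel/ls-inputs` lines `thm61-cm-convolution` (SKELETON P64) / `theta-circle-method` (S3) /
`theta-voronoi` (S3d) / `theta-omega` (V1), namely V1 `stub_theta_omega` (the `ω`-relation
(2.23)–(2.39) of the class-group theta series), landed as `theta_omega` (seat ls-inputs-P64-w9), and
`proposition64_of_theta_omega` (this seat) is the rest of §§2–6 by name: S1 kernel, S2a–c Theorem 6.1 /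
Corollary 6.2, S4 diagonal, S5 off-diagonal, S6 absorption (P64); S3a (4.24), S3b Theorem 4.1
(zero detector, incomplete Kloosterman sums, assembly), S3c (4.5) for the Bessel kernels, S3e genus
theory and (4.27)–(4.34), S3f absorption (S3); V2 Hecke–Voronoi at weight one, V3 theta constants (S3d);
Ω1 Gauss sums of binary forms at the cusps, Ω2 reassembly over `Cl(K)` (V1). (The hypothesis-free S3
statement itself is the tree's `ConreyIwaniec2002.shifted_convolution`, seat ls-inputs-S3-lead g2.) This is CI 2002
Proposition 6.4 ONLY — the mean-square input of §§8–9; nothing here proves Landau–Siegel, GRH,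
Theorems 1.1/1.2 of the source or anything about real zeros.

## References
* [ConreyIwaniec2002] B. Conrey, H. Iwaniec, Acta Arith. 103 (2002) 259–312: Proposition 6.4 (6.52);
  Theorems 4.3/4.4 (4.25)–(4.26).
-/

noncomputable section

open scoped NumberField
open Complex MeasureTheory

namespace Literature.NumberTheory.LFunctions

open NumberField Literature.NumberTheory.LFunctions.NumberField

/-- **Conrey–Iwaniec 2002, Proposition 6.4, PROVED** (discharge of the named fact
`conreyIwaniec2002_proposition64`): `∃ C > 0, ∀ q > 4 odd, χ mod q primitive quadratic odd,
K ([K:ℚ] = 2, d_K = −q), ψ ∈ Ĉl(K), T ≥ q^65, a ∈ IsCutoff · T (qT):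
∫_T^{2T} |Σ_n a(n)λ_ψ(n)n^{−1/2−it}|² dt ≤ C·Tℒ(T)log q`.
[cite: ConreyIwaniec2002, Proposition 6.4 (6.52)] -/
theorem conreyIwaniec2002_proposition64_holds : conreyIwaniec2002_proposition64 :=
  ConreyIwaniec2002.proposition64_of_theta_omega ConreyIwaniec2002.theta_omega

namespace ConreyIwaniec2002

/-- **Proposition 6.4 holds** (alias in the paper's namespace, the CLOSING RECIPE of the P64 line:
`proposition64_holds := proposition64_of_theta_omega theta_omega`).
[cite: ConreyIwaniec2002, Proposition 6.4 (6.52)] -/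
theorem proposition64_holds : conreyIwaniec2002_proposition64 :=
  conreyIwaniec2002_proposition64_holds

end ConreyIwaniec2002

end Literature.NumberTheory.LFunctions

end
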